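import Mathlib
import Literature.Computability.AlgebraicComplexity.TotalBaurStrassen
import Literature.Computability.AlgebraicComplexity.GKSS19Preprocessing
import Literature.RingTheory.MvPolynomial.RuppertReducibleProofs
import Summits.ValiantsHypothesis.ValiantsHypothesis.Theorems.BarrierLeverDefinableEquationsDifferentialClosure

/-!
# Crux `BarrierLever.DefinableEquations` (stmt-8745) / `SingleSizeEquations` (stmt-8749) —
# DIFFERENTIAL CLOSURE down the size axis, II: the crux's WITNESSES descend (val-np-p5 g8)

Part I (`…DifferentialClosure.lean`): an equation `E` for size `s + 2n + 2` has every coordinate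
derivative `∂_μ^a E` an equation for size `s` (`DifferentialClosure.iterate_pderiv_vanishes`).
Here this is transported to the crux's data — Boolean sums `E = boolSum H` of poly(`N`)-size
polynomials `H`, `N = C(2n, n)`:

* **§6** `∂/∂c_μ` commutes with Valiant's Boolean sum over the other variables
  (`pderiv_boolSum`, `iterate_pderiv_boolSum`; chain rule `SLProgram.pderiv_aeval_eq_sum`); a
  coordinate derivative of any order costs `L(∂_μ^r H) ≤ (deg H + 1)(L(H) + 2) + deg H + 2`
  (GKSS 2019 §3 interpolation = tree `GKSS2019.complexity_iterate_pderiv_le`, completed by the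
  vanishing of `∂_μ^r H` beyond the degree, `GKSS2019.iterate_pderiv_eq_zero_of_degreeOf_lt`) and does not raise
  the degree; and in characteristic `0`, `∂_μ^r E ≠ 0` as long as `r ≤` the `μ`-exponent of some
  monomial of `E` (`coeff_iterate_pderiv`, `iterate_pderiv_ne_zero`).
* **§7 `witness_derivative`.**  A level-`a` datum `H` at `(n, b)` (`L(H), deg H ≤ N^a`,
  `boolSum H` vanishing on `coeff(SmallCircuits ℂ n b)`) yields, for every `μ, r` as above, the
  level-`(2a+2)` datum `∂_{inl μ}^r H` at `(n, b')` whenever `n^{b'} + 2n + 2 ≤ n^b`, with Boolean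
  sum `∂_μ^r (boolSum H)`, NONZERO, vanishing on `coeff(SmallCircuits ℂ n b')`.
  **`eq_descends_by_derivative`**: `Eq(n, b, a) ⇒ Eq(n, b', 2a+2)` for `1 ≤ b' < b`, `n ≥ 4`,
  witnessed by a FIRST partial derivative of the same datum (an equation against a class
  containing `0` is non-constant, `exists_support_pos`).  So the family of equations the crux
  asks for may be taken CLOSED UNDER `∂/∂c_μ` down the size axis, at the price `a ↦ 2a + 2`
  per rung — one more normal-form freedom next to the isobaric / highest-weight / combinatorial
  forms of g5–g7, and a test: a candidate witness at `b` must have nonzero derivatives that are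
  again candidates at every `b' < b`.

What this is NOT.  No verdict on the crux moves (b = 2 OPEN, Chatterjee–Tengse 2023 §1.3
dir. 2); nothing here bears on `VP ≠ VNP`.  No definitions, no named facts; standard axioms.
Refs: Bürgisser 2000 §2.1; Guo–Kumar–Saptharishi–Solomon 2019 §3; Valiant 1979 (Boolean sums).
-/

-- `Summit.ValiantsHypothesis.ValiantsHypothesis.…` repeats a component by the D-0017 layout
-- (single-conjunct summit), which the `dupNamespace` linter flags; the name is mandated.
set_option linter.dupNamespace false

noncomputable section

namespace Summit.ValiantsHypothesis.ValiantsHypothesis.Theorems.BarrierLeverDefinableEquations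

open MvPolynomial
open Literature.Computability.AlgebraicComplexity Literature.Barriers.ValiantsHypothesis
open Literature.RepresentationTheory.AlgebraicGroups (iterPderiv iterPderiv_add iterPderiv_single
  iterPderiv_zero iterPderiv_monomial iterPderivWeight)
open scoped BigOperators

namespace DifferentialClosure

/-! ## §6 Boolean sums are closed under coordinate derivatives: the crux's witnesses descend -/

section BoolSumDerivatives

variable {τ : Type*} [Fintype τ] [DecidableEq τ]

/-- `∂/∂c_μ` commutes with Valiant's Boolean sum over the OTHER variables:
`∂_μ (Σ_e H(c, e)) = Σ_e (∂_{inl μ} H)(c, e)`. [folklore] -/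
theorem pderiv_boolSum {q : ℕ} (H : MvPolynomial (τ ⊕ Fin q) ℂ) (μ : τ) :
    pderiv μ (boolSum H) = boolSum (pderiv (Sum.inl μ) H) := by
  unfold boolSum
  rw [map_sum]
  refine Finset.sum_congr rfl fun e _ => ?_
  rw [SLProgram.pderiv_aeval_eq_sum, Fintype.sum_sum_type]
  have hinr : ∑ j : Fin q, aeval (Sum.elim X fun j => if e j then (1 : MvPolynomial τ ℂ) else 0)
      (pderiv (Sum.inr j) H) * pderiv μ (Sum.elim X (fun j => if e j then
        (1 : MvPolynomial τ ℂ) else 0) (Sum.inr j)) = 0 := by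
    refine Finset.sum_eq_zero fun j _ => ?_
    rw [Sum.elim_inr]
    split_ifs <;> simp
  rw [hinr, add_zero, Finset.sum_eq_single μ]
  · rw [Sum.elim_inl, pderiv_X, Pi.single_eq_same, mul_one]
  · intro ν _ hν
    rw [Sum.elim_inl, pderiv_X, Pi.single_eq_of_ne hν, mul_zero]
  · intro h; exact absurd (Finset.mem_univ μ) h

/-- Iterated form: `∂_μ^a (boolSum H) = boolSum (∂_{inl μ}^a H)`. [folklore] -/
theorem iterate_pderiv_boolSum {q : ℕ} (H : MvPolynomial (τ ⊕ Fin q) ℂ) (μ : τ) (a : ℕ) :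
    (pderiv μ)^[a] (boolSum H) = boolSum ((pderiv (Sum.inl μ))^[a] H) := by
  induction a generalizing H with
  | zero => rfl
  | succ a ih => rw [Function.iterate_succ_apply, Function.iterate_succ_apply, pderiv_boolSum, ih]

end BoolSumDerivatives

/-- Iterated partial derivatives do not raise the total degree. [folklore] -/
theorem totalDegree_iterate_pderiv_le {σ : Type*} (i : σ) (f : MvPolynomial σ ℂ) (a : ℕ) :
    ((pderiv i)^[a] f).totalDegree ≤ f.totalDegree := by
  induction a generalizing f with
  | zero => exact le_rfl
  | succ a ih =>
    rw [Function.iterate_succ_apply]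
    exact (ih _).trans ((Literature.RingTheory.MvPolynomial.Ruppert.totalDegree_pderiv_le i f).trans
      (Nat.sub_le _ _))

/-- **Cost of a coordinate derivative of any order** (GKSS 2019 §3 interpolation, tree
`GKSS2019.complexity_iterate_pderiv_le`, with the vanishing beyond the degree):
`L(∂_μ^a f) ≤ (D+1)(L(f)+2) + (D+1) + 1`, `D = deg f`. [cite: GuoKumarSaptharishiSolomon2019, §3] -/
theorem complexity_iterate_pderiv_le' {σ : Type*} [Fintype σ] [DecidableEq σ] (μ : σ)
    (f : MvPolynomial σ ℂ) (a : ℕ) :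
    complexity ((pderiv μ)^[a] f) ≤
      (f.totalDegree + 1) * (complexity f + 2) + (f.totalDegree + 1) + 1 := by
  by_cases ha : a ≤ f.totalDegree
  · exact GKSS2019.complexity_iterate_pderiv_le μ f (degreeOf_le_totalDegree f μ) ha
  · rw [GKSS2019.iterate_pderiv_eq_zero_of_degreeOf_lt μ f
        ((degreeOf_le_totalDegree f μ).trans_lt (not_le.mp ha)),
      ← C_0, complexity_C_holds]
    exact Nat.zero_le _

/-- Coefficients of iterated coordinate derivatives:
`coeff_m (∂_μ^a f) = (m_μ + a)(m_μ + a - 1)⋯(m_μ + 1) · coeff_{m + a e_μ} f`. [folklore] -/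
theorem coeff_iterate_pderiv {σ : Type*} (μ : σ) (f : MvPolynomial σ ℂ) (a : ℕ) (m : σ →₀ ℕ) :
    coeff m ((pderiv μ)^[a] f) =
      ((m μ + a).descFactorial a : ℂ) * coeff (m + Finsupp.single μ a) f := by
  induction a generalizing m with
  | zero => simp
  | succ a ih =>
    have hs : m + Finsupp.single μ 1 + Finsupp.single μ a = m + Finsupp.single μ (a + 1) := by
      rw [add_assoc, ← Finsupp.single_add, add_comm 1 a]
    have hμ : (m + Finsupp.single μ 1 : σ →₀ ℕ) μ + a = m μ + (a + 1) := by
      simp only [Finsupp.coe_add, Pi.add_apply, Finsupp.single_eq_same]; omega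
    rw [Function.iterate_succ_apply', coeff_pderiv, ih, hs, hμ, Nat.descFactorial_succ,
      show m μ + (a + 1) - a = m μ + 1 by omega]
    push_cast
    ring

/-- **Nonvanishing of coordinate derivatives (characteristic `0`)**: if some monomial of `f` has
`μ`-exponent `≥ a` then `∂_μ^a f ≠ 0`. [folklore] -/
theorem iterate_pderiv_ne_zero {σ : Type*} (μ : σ) {f : MvPolynomial σ ℂ} {a : ℕ}
    {s₀ : σ →₀ ℕ} (hs₀ : s₀ ∈ f.support) (ha : a ≤ s₀ μ) : (pderiv μ)^[a] f ≠ 0 := by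
  classical
  intro h
  have hle : Finsupp.single μ a ≤ s₀ := by
    intro ν
    by_cases hν : ν = μ
    · subst hν; simpa using ha
    · rw [Finsupp.single_apply, if_neg (fun h => hν h.symm)]; exact Nat.zero_le _
  have hc := coeff_iterate_pderiv μ f a (s₀ - Finsupp.single μ a)
  rw [h, coeff_zero, tsub_add_cancel_of_le hle] at hc
  refine mul_ne_zero ?_ (mem_support_iff.mp hs₀) hc.symm
  have hμ : (s₀ - Finsupp.single μ a) μ + a = s₀ μ := by
    simp only [Finsupp.coe_tsub, Pi.sub_apply, Finsupp.single_eq_same]; omega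
  rw [hμ]
  have hne : (s₀ μ).descFactorial a ≠ 0 := fun h0 =>
    absurd ha (not_le.mpr (Nat.descFactorial_eq_zero_iff_lt.mp h0))
  exact_mod_cast hne

/-! ## §7 The crux's witnesses descend the size axis by differentiation -/

/-- `3 ≤ C(2n, n)` for `n ≥ 2`. [folklore] -/
theorem three_le_centralBinom {n : ℕ} (hn : 2 ≤ n) : 3 ≤ Nat.choose (2 * n) n := by
  have h1 := Nat.choose_le_middle 1 (2 * n)
  rw [Nat.choose_one_right, Nat.mul_div_cancel_left n Nat.two_pos] at h1
  omega

/-- Level bookkeeping: `(D+1)(L+2) + (D+1) + 1 ≤ N^(2a+2)` for `L, D ≤ N^a`, `N ≥ 3`. [folklore] -/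
theorem level_arith {N a L D : ℕ} (hN : 3 ≤ N) (hL : L ≤ N ^ a) (hD : D ≤ N ^ a) :
    (D + 1) * (L + 2) + (D + 1) + 1 ≤ N ^ (2 * a + 2) := by
  have h1 : 1 ≤ N ^ a := Nat.one_le_pow _ _ (by omega)
  have h2 : N ^ a + 2 ≤ N ^ a * N := by nlinarith
  calc (D + 1) * (L + 2) + (D + 1) + 1 ≤ (N ^ a + 1) * (N ^ a + 2) + (N ^ a + 1) + 1 := by
        gcongr
    _ = (N ^ a + 2) * (N ^ a + 2) := by ring
    _ ≤ (N ^ a * N) * (N ^ a * N) := Nat.mul_le_mul h2 h2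
    _ = N ^ (2 * a + 2) := by ring

/-- **Derivatives of a Boolean-sum witness are Boolean-sum witnesses one rung down.**  Let
`E = boolSum H` be a level-`a` datum at `n ≥ 2` (`L(H), deg H ≤ N^a`, `N = C(2n,n)`) vanishing on
`coeff(SmallCircuits ℂ n b)`, and let `n^{b'} + 2n + 2 ≤ n^b`.  Then for every coordinate `μ` and
every order `r` not exceeding the `μ`-exponent of some monomial of `E`, the datum
`H' = ∂_{inl μ}^r H` has `L(H') ≤ N^(2a+2)`, `deg H' ≤ N^a`, Boolean sum `boolSum H' = ∂_μ^r E`,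
which is NONZERO and vanishes on `coeff(SmallCircuits ℂ n b')`.  (Cost: GKSS 2019 §3
interpolation; vanishing: §2; nonvanishing: characteristic `0`.) [folklore] -/
theorem witness_derivative {n b b' a q : ℕ} (hn : 2 ≤ n) (hbb : n ^ b' + (2 * n + 2) ≤ n ^ b)
    {H : MvPolynomial (↥(degLEMonomials n) ⊕ Fin q) ℂ}
    (hc : complexity H ≤ Nat.choose (2 * n) n ^ a) (hd : H.totalDegree ≤ Nat.choose (2 * n) n ^ a)
    (hvan : ∀ f ∈ SmallCircuits ℂ n b,
      eval (coeffVector (degLEMonomials n) f) (boolSum H) = 0)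
    (μ : ↥(degLEMonomials n)) {r : ℕ} {s₀ : ↥(degLEMonomials n) →₀ ℕ}
    (hs₀ : s₀ ∈ (boolSum H).support) (hr : r ≤ s₀ μ) :
    complexity ((pderiv (Sum.inl μ))^[r] H) ≤ Nat.choose (2 * n) n ^ (2 * a + 2) ∧
      ((pderiv (Sum.inl μ))^[r] H).totalDegree ≤ Nat.choose (2 * n) n ^ a ∧
      boolSum ((pderiv (Sum.inl μ))^[r] H) = (pderiv μ)^[r] (boolSum H) ∧
      boolSum ((pderiv (Sum.inl μ))^[r] H) ≠ 0 ∧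
      ∀ f ∈ SmallCircuits ℂ n b',
        eval (coeffVector (degLEMonomials n) f) (boolSum ((pderiv (Sum.inl μ))^[r] H)) = 0 := by
  haveI : Fintype ↥(degLEMonomials n) := (Finsupp.finite_of_degree_le (σ := Fin n) n).fintype
  have hbs : boolSum ((pderiv (Sum.inl μ))^[r] H) = (pderiv μ)^[r] (boolSum H) :=
    (iterate_pderiv_boolSum H μ r).symm
  refine ⟨?_, (totalDegree_iterate_pderiv_le _ H r).trans hd, hbs, ?_, ?_⟩
  · exact (complexity_iterate_pderiv_le' (Sum.inl μ) H r).trans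
      (level_arith (three_le_centralBinom hn) hc hd)
  · rw [hbs]; exact iterate_pderiv_ne_zero μ hs₀ hr
  · rw [hbs]; exact iterate_pderiv_vanishes_on_smallCircuits hbb hvan μ r

/-- An equation against a class containing `0` is not a constant: some monomial of it has a
positive exponent in some coordinate. [folklore] -/
theorem exists_support_pos {n b : ℕ} {E : MvPolynomial ↥(degLEMonomials n) ℂ} (hE0 : E ≠ 0)
    (hE : ∀ f ∈ SmallCircuits ℂ n b, eval (coeffVector (degLEMonomials n) f) E = 0) :
    ∃ s₀ ∈ E.support, ∃ μ, 1 ≤ s₀ μ := by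
  classical
  by_contra hno
  push Not at hno
  -- every monomial of `E` is the constant one, so `E = C (coeff 0 E)` is a nonzero constant
  have hsupp : ∀ s ∈ E.support, s = 0 := fun s hs => by
    ext μ; have := hno s hs μ; simp only [Finsupp.coe_zero, Pi.zero_apply]; omega
  have hEC : E = C (coeff 0 E) := by
    conv_lhs => rw [E.as_sum]
    rw [Finset.sum_eq_single_of_mem (0 : ↥(degLEMonomials n) →₀ ℕ)]
    · rfl
    · by_contra h0
      apply hE0
      rw [E.as_sum]
      exact Finset.sum_eq_zero fun s hs => absurd (hsupp s hs ▸ hs) h0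
    · intro s hs hs0; exact absurd (hsupp s hs) hs0
  have h0mem : (0 : MvPolynomial (Fin n) ℂ) ∈ SmallCircuits ℂ n b := by
    refine ⟨by rw [totalDegree_zero]; exact Nat.zero_le _, ?_⟩
    rw [← C_0, complexity_C_holds]; exact Nat.zero_le _
  have := hE 0 h0mem
  rw [hEC, eval_C] at this
  apply hE0
  rw [hEC, this, C_0]

/-- **`Eq(n, b, a) ⇒ Eq(n, b', 2a+2)` by a FIRST partial derivative of the same datum**
(`1 ≤ b' < b`, `n ≥ 4`): if `(q, H)` witnesses the inner statement of `SingleSizeEquations` /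
`DefinableEquations` at `(n, b)` with level `a`, then for some coefficient coordinate `μ` the
datum `(q, ∂_{inl μ} H)` witnesses it at `(n, b')` with level `2a + 2`, and its Boolean sum is
`∂_μ (boolSum H)`.  The level-`a` family of equations the crux asks for may therefore be taken
CLOSED UNDER DIFFERENTIATION down the size axis (at the price `a ↦ 2a + 2` per step).
[folklore] -/
theorem eq_descends_by_derivative {n b b' a q : ℕ} (hn : 4 ≤ n) (hb' : 1 ≤ b') (hb : b' + 1 ≤ b)
    {H : MvPolynomial (↥(degLEMonomials n) ⊕ Fin q) ℂ} (hq : q ≤ Nat.choose (2 * n) n ^ a)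
    (hc : complexity H ≤ Nat.choose (2 * n) n ^ a) (hd : H.totalDegree ≤ Nat.choose (2 * n) n ^ a)
    (hne : boolSum H ≠ 0)
    (hvan : ∀ f ∈ SmallCircuits ℂ n b,
      eval (coeffVector (degLEMonomials n) f) (boolSum H) = 0) :
    ∃ μ : ↥(degLEMonomials n),
      q ≤ Nat.choose (2 * n) n ^ (2 * a + 2) ∧
      complexity (pderiv (Sum.inl μ) H) ≤ Nat.choose (2 * n) n ^ (2 * a + 2) ∧
      (pderiv (Sum.inl μ) H).totalDegree ≤ Nat.choose (2 * n) n ^ (2 * a + 2) ∧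
      boolSum (pderiv (Sum.inl μ) H) = pderiv μ (boolSum H) ∧
      boolSum (pderiv (Sum.inl μ) H) ≠ 0 ∧
      ∀ f ∈ SmallCircuits ℂ n b',
        eval (coeffVector (degLEMonomials n) f) (boolSum (pderiv (Sum.inl μ) H)) = 0 := by
  obtain ⟨s₀, hs₀, μ, hμ⟩ := exists_support_pos hne hvan
  have hN : 3 ≤ Nat.choose (2 * n) n := three_le_centralBinom (by omega)
  have hpow : Nat.choose (2 * n) n ^ a ≤ Nat.choose (2 * n) n ^ (2 * a + 2) :=
    Nat.pow_le_pow_right (by omega) (by omega)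
  obtain ⟨h1, h2, h3, h4, h5⟩ := witness_derivative (r := 1) (by omega)
    (pow_add_translate_le hb' hb hn) hc hd hvan μ hs₀ hμ
  exact ⟨μ, hq.trans hpow, h1, h2.trans hpow, h3, h4, h5⟩

/-! ## §8 The open rung `b = 2`, numerically -/

/-- **At `b = 2` (the first open rung of the crux), `n ≥ 4`:** every equation for
`SmallCircuits ℂ n 2` vanishes, together with ALL its mixed partial derivatives in at most
`(n - 2) / 2` distinct coefficient coordinates (any orders), on `SmallCircuits ℂ n 1` — the class
of rung one (size `≤ n`: e.g. every power `(Σ_{i ≤ n - 2 log₂ k} a_i x_i)^k`, `k ≤ n`, every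
product of two sparse polynomials of total cost `≤ n`).  Equivalently the hypersurface `{E = 0}`
contains every affine coordinate `((n-2)/2)`-plane through every point of
`coeff(SmallCircuits ℂ n 1)`. [folklore] -/
theorem rung_two {n : ℕ} (hn : 4 ≤ n) {E : MvPolynomial ↥(degLEMonomials n) ℂ}
    (hE : ∀ f ∈ SmallCircuits ℂ n 2, eval (coeffVector (degLEMonomials n) f) E = 0)
    {β : ↥(degLEMonomials n) →₀ ℕ} (hβ : β.support.card ≤ (n - 2) / 2) :
    ∀ f ∈ SmallCircuits ℂ n 1,
      eval (coeffVector (degLEMonomials n) f) (iterPderiv (A := ℂ) β E) = 0 := by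
  refine iterPderiv_vanishes_on_smallCircuits (b := 2) (b' := 1) (k := (n - 2) / 2) ?_ hE hβ
  have hk : 2 * ((n - 2) / 2) + 2 ≤ n := by omega
  rw [pow_one, sq]
  nlinarith [hk, Nat.zero_le ((n - 2) / 2)]

/-- **At `b = 2`, witnesses descend to rung one:** a level-`a` Boolean-sum equation for
`SmallCircuits ℂ n 2` (`n ≥ 4`) has a first partial derivative which is a level-`(2a+2)`
Boolean-sum equation for `SmallCircuits ℂ n 1` (where the tree HAS unconditional equations,
`…RungOne`).  So any proof of the open rung must produce a datum whose coordinate derivatives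
are (nonzero) rung-one equations of the same Boolean-sum shape. [folklore] -/
theorem rung_two_descends {n a q : ℕ} (hn : 4 ≤ n)
    {H : MvPolynomial (↥(degLEMonomials n) ⊕ Fin q) ℂ} (hq : q ≤ Nat.choose (2 * n) n ^ a)
    (hc : complexity H ≤ Nat.choose (2 * n) n ^ a) (hd : H.totalDegree ≤ Nat.choose (2 * n) n ^ a)
    (hne : boolSum H ≠ 0)
    (hvan : ∀ f ∈ SmallCircuits ℂ n 2,
      eval (coeffVector (degLEMonomials n) f) (boolSum H) = 0) :
    ∃ μ : ↥(degLEMonomials n),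
      q ≤ Nat.choose (2 * n) n ^ (2 * a + 2) ∧
      complexity (pderiv (Sum.inl μ) H) ≤ Nat.choose (2 * n) n ^ (2 * a + 2) ∧
      (pderiv (Sum.inl μ) H).totalDegree ≤ Nat.choose (2 * n) n ^ (2 * a + 2) ∧
      boolSum (pderiv (Sum.inl μ) H) = pderiv μ (boolSum H) ∧
      boolSum (pderiv (Sum.inl μ) H) ≠ 0 ∧
      ∀ f ∈ SmallCircuits ℂ n 1,
        eval (coeffVector (degLEMonomials n) f) (boolSum (pderiv (Sum.inl μ) H)) = 0 :=
  eq_descends_by_derivative hn le_rfl (by norm_num) hq hc hd hne hvan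

end DifferentialClosure

end Summit.ValiantsHypothesis.ValiantsHypothesis.Theorems.BarrierLeverDefinableEquations
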